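import Literature.InformationTheory.QuantumCodes.ConcatenationBadnessRecursion
import Literature.InformationTheory.QuantumCodes.PauliNoise
import HarnessLib

/-!
# The badness probability of `ConcatenationBadnessRecursion.lean` IS a `PMF` mass (independent Bernoulli faults)

Topic `Literature/InformationTheory/QuantumCodes` (continues `ConcatenationBadnessRecursion.lean`). There `AGP06.badProb p n k` is the
finite sum `Σ_{x bad} ∏_v (x v ? p : 1 - p)`; here it is identified with the probability, under the product law `iidLaw (faultLaw p)` (`faultLaw` = the Bernoulli law on `Bool`)
of the tree's noise vocabulary (`PauliNoise.lean`: "the errors acting on different qubits are independent"), of the event "the level-`k`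
structure is bad" — so that Lemma 2 reads as a bound on a genuine probability:

* `faultLaw`, `toReal_iidLaw_faultLaw` — the product fault law gives a fault pattern its weight `wt p k x`;
* **`toReal_prob_isBad_eq_badProb`** — `ℙ(bad at level k) = badProb p n k`;
* **`prob_isBad_le_levelBound`** — `ℙ(bad at level k) ≤ ε₀ (p/ε₀)^{2^k}`, `ε₀ = (n choose 2)⁻¹` (AGP06 Lemma 2 as a probability statement).

## References

* [AliferisGottesmanPreskill2006] P. Aliferis, D. Gottesman, J. Preskill, Quantum Inf. Comput. 6 (2006) 97–165, §3.1 ("stochastic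
  faults occur independently, with probability ε, at each circuit location"), Lemma 2.
-/

noncomputable section

open Finset
open scoped BigOperators ENNReal NNReal

namespace Literature.InformationTheory.QuantumCodes

namespace AGP06

variable {n : ℕ}

/-- **The fault law at one location**: faulty (`true`) with probability `p`, sound with probability `1 - p` (the Bernoulli law on
`Bool`; cf. `bitLaw` on `𝔽₂` in `IIDBitFlip.lean`). [cite: AliferisGottesmanPreskill2006, §3.1 (independent faults of rate ε)] -/
def faultLaw (p : ℝ≥0) (hp : p ≤ 1) : PMF Bool :=
  PMF.ofFintype (fun b => if b then (p : ℝ≥0∞) else ((1 - p : ℝ≥0) : ℝ≥0∞)) (by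
    rw [Fintype.sum_bool]
    simp only [if_true, Bool.false_eq_true, if_false]
    rw [← ENNReal.coe_add, add_tsub_cancel_of_le hp, ENNReal.coe_one])

/-- The fault law at a location: `p` at `true`, `1 - p` at `false`. [cite: AliferisGottesmanPreskill2006, §3.1] -/
theorem faultLaw_apply (p : ℝ≥0) (hp : p ≤ 1) (b : Bool) :
    faultLaw p hp b = if b then (p : ℝ≥0∞) else ((1 - p : ℝ≥0) : ℝ≥0∞) := rfl

/-- The product fault law gives the fault pattern `x` probability `wt p k x = ∏_v (x v ? p : 1 - p)`.
[cite: AliferisGottesmanPreskill2006, §3.1 (independent faults of rate ε)] -/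
theorem toReal_iidLaw_faultLaw (p : ℝ≥0) (hp : p ≤ 1) (k : ℕ) (x : (Fin k → Fin n) → Bool) :
    (iidLaw (faultLaw p hp) x).toReal = wt (p : ℝ) k x := by
  rw [iidLaw_apply, ENNReal.toReal_prod]
  unfold wt
  refine Finset.prod_congr rfl fun v _ => ?_
  rw [faultLaw_apply]
  cases x v
  · simp only [Bool.false_eq_true, if_false, ENNReal.coe_toReal, NNReal.coe_sub hp, NNReal.coe_one]
  · simp

/-- **`ℙ(bad at level k) = badProb p n k`**: the badness probability of `ConcatenationBadnessRecursion.lean` is the mass of the event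
`{x | IsBad n k x}` under independent rate-`p` faults. [cite: AliferisGottesmanPreskill2006, §3.1 (ε^{(k)})] -/
theorem toReal_prob_isBad_eq_badProb (p : ℝ≥0) (hp : p ≤ 1) (n k : ℕ) :
    ((iidLaw (faultLaw p hp)).toOuterMeasure {x : (Fin k → Fin n) → Bool | IsBad n k x}).toReal = badProb (p : ℝ) n k := by
  rw [PMF.toOuterMeasure_apply_fintype, ENNReal.toReal_sum (fun x _ => ?_)]
  · unfold badProb
    refine Finset.sum_congr rfl fun x _ => ?_
    by_cases hx : IsBad n k x
    · rw [Set.indicator_of_mem (show x ∈ {x | IsBad n k x} from hx), if_pos hx, toReal_iidLaw_faultLaw]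
    · rw [Set.indicator_of_notMem (show x ∉ {x | IsBad n k x} from hx), if_neg hx, ENNReal.toReal_zero]
  · exact ne_top_of_le_ne_top ENNReal.one_ne_top
      ((Set.indicator_le_self _ _ x).trans (PMF.coe_le_one _ x))

/-- **Lemma 2 as a probability statement**: under independent faults of rate `p ≤ 1` on the `n^k` locations (`n ≥ 2`), the
probability that the level-`k` structure is bad is at most `ε₀ (p/ε₀)^{2^k}`, `ε₀ = (n choose 2)⁻¹`.
[cite: AliferisGottesmanPreskill2006, Lemma 2] -/
theorem prob_isBad_le_levelBound (p : ℝ≥0) (hp : p ≤ 1) (hn : 2 ≤ n) (k : ℕ) :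
    ((iidLaw (faultLaw p hp)).toOuterMeasure {x : (Fin k → Fin n) → Bool | IsBad n k x}).toReal ≤
      levelBound ((n.choose 2 : ℝ)⁻¹) p k := by
  rw [toReal_prob_isBad_eq_badProb]
  exact badProb_le_levelBound p.coe_nonneg (by exact_mod_cast hp) hn k

end AGP06

end Literature.InformationTheory.QuantumCodes

end
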